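import Literature.MathematicalPhysics.QuantumFieldTheory.Balaban1983to89.B9SectBQLawsOfKernelY
import Literature.MathematicalPhysics.QuantumFieldTheory.Balaban1983to89.B9SectBQLettersL2QY

/-!
# Balaban [B9], (3.15) p. 393 in block-`ℓ²` ([4] Prop. 2.6 (2.140) p. 247) for a GENERIC averaging pair `(𝔮, 𝔮s)` — SCHUR's TEST WITH AN ABSTRACT KERNEL: the
# displayed block-`ℓ²` size law `hQL2` of the K2-G `L²` frame REDUCED TO KERNEL DATA (rows, volume-weighted columns, support) — the `ℓ²` companion of
# `B9SectBQLawsOfKernelY` (CASCADE-K piece «K2-G», stage L0)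

T. Bałaban, *Propagators for lattice gauge theories in a background field*, Commun. Math. Phys. **99** (1985) 389–434
[`Balaban1985BackgroundPropagators`, "B9"]; [4] = [`Balaban1984PropagatorsII`]; [B8] = [`Balaban1985Averaging`].

statement-level skeleton of published theorems with citation tags; proofs where landed; nothing here is a claim about the Yang–Mills mass gap

WHY THIS FILE (seat dag-n06-c gen 25; «K2-G-L1», dag-n06-l I.20442 «please type it»).  `B9SectBQLettersL2Y` §3 proves Schur's test for the straight kernel `|qK|`
(rows `= 1`, volume-weighted columns `≦ 2L^{d+1}`, support `ℓ + 3`).  THIS FILE abstracts the kernel: ★★ `l2_indB_le_of_kernel` (Q side: a letter `T` vanishing off the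
representatives with `‖(TΛ)(rep κ)‖ ≦ √vol(κ)·c·Σ_f k(κ,f)‖Λ f‖`, rows `≦ R`, volume-weighted columns `≦ Cv`, support radius `r` in the labelled blocks `ιB ∘ blkV1` ⟹
`‖1_{Δ(y)}·T(J ⊗ E)‖₂ ≦ c·√(R·Cv)·e^{δr}·e^{−δd(y,y′)}·‖J‖₂`), ★★ `l2_indB_le_of_adjKernel` (Q* side: `‖(TΛ)(q)‖ ≦ c·Σ_κ k(κ,q)·√vol(κ)·‖Λ(rep κ)‖` ⟹ the same);
★★ `hasL2Majorant_QbQC2_of_rowKernel` ∕ `hasL2Majorant_QsbQC2_of_colKernel` (the ℓ² coded letters `QbQC2 𝔮 = conj b (ext∘√vol∘𝔮)`, `QsbQC2 𝔮s = conj b (𝔮s∘√vol∘res)` of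
`B9SectBQLettersL2QY`); ★ `hQL2_of_kernels` — the member-level packaging in EXACTLY the binder shape `hQL2` of `B9SectBL2GFrameSelQY.l2GFrame₈CodedOnSelQ`, from the same
guarded kernel data as `B9SectBQLawsOfKernelY.hQ15_of_kernels` (`κQ2 := (√|ι|·M₂Σ‖b_j‖)·√(C·C)·e^{r}`).

HONEST SCOPE.  Finite-dimensional bookkeeping (Cauchy–Schwarz) over DEFINED objects; the kernel bounds are HYPOTHESES; nothing of [B9] asserted; count-neutral; N06
NOT discharged; nothing continuum ∕ OS ∕ mass-gap ∕ Clay.  0 `def`, 0 `sorry`.  `--supports stmt-QuantumFields-27364`.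

RELATED IN THE TREE, NOT DUPLICATED: `B9SectBQLettersL2Y` §3–§4 (the straight instance; its tools `indB`, `sum_eq_sum_repBondY`, `sum_comp_repBondY_le`, `norm_liftY_apply_le`,
`hasL2Majorant_conjB_of_indBound`, `hasL2Majorant_conj_bondOpCoordsRY` are USED), `B9SectBQLawsOfKernelY` (the sup companion).
-/

noncomputable section

namespace Literature.MathematicalPhysics.QuantumFieldTheory.Balaban1983to89.B9SectBQLawsL2OfKernelY

open Literature.MathematicalPhysics.QuantumFieldTheory.Balaban1983to89
open Literature.MathematicalPhysics.QuantumFieldTheory.Balaban1983to89.Node00 (SiteY BlkY FBondY IBondY CfgY liftY liftY_apply l2OfY liftMatY liftMatY_diagonal_apply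
  extBondY resBondY repBondY bondCoordsY bondFunCoordsY extBondY_apply_repBondY extBondY_apply_of_not_mem_range resBondY_apply)
open Literature.MathematicalPhysics.QuantumFieldTheory.Balaban1983to89.B6Ineq2142KLevelV1 (β)
open Literature.MathematicalPhysics.QuantumFieldTheory.Balaban1983to89.B6GlobalChartV1 (blkV1)
open Literature.MathematicalPhysics.QuantumFieldTheory.Balaban1983to89.B6KLevelCensusIndexV1 (KIdx kGeo)
open Literature.MathematicalPhysics.QuantumFieldTheory.Balaban1983to89.B6RandomWalk (HasMajorant)
open Literature.MathematicalPhysics.QuantumFieldTheory.Balaban1983to89.B6RandomWalkL2 (l2n l2n_sq l2n_nonneg HasL2Majorant hasL2Majorant_mono)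
open Literature.MathematicalPhysics.QuantumFieldTheory.Balaban1983to89.B9Thm34Ext (toB6)
open Literature.MathematicalPhysics.QuantumFieldTheory.Balaban1983to89.B9GeoNormsKLevelV1 (geo9K)
open Literature.MathematicalPhysics.QuantumFieldTheory.Balaban1983to89.B9GeoLemma21KLevelV1 (geo9K_dist_comm)
open Literature.MathematicalPhysics.QuantumFieldTheory.Balaban1983to89.B9PinMembersKLevelV1 (MemberY geo9Y)
open Literature.MathematicalPhysics.QuantumFieldTheory.Balaban1983to89.B9Eq352DivFormLetters (conj)
open Literature.MathematicalPhysics.QuantumFieldTheory.Balaban1983to89.B9Eq360DeltaPrimeAY (blkY AfldY)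
open Literature.MathematicalPhysics.QuantumFieldTheory.Balaban1983to89.B9SectBGpLettersY (GVal decY decY_base blkC)
open Literature.MathematicalPhysics.QuantumFieldTheory.Balaban1983to89.B9SectBCodedCarrier (CCfg)
open Literature.MathematicalPhysics.QuantumFieldTheory.Balaban1983to89.B9SectBGWordDeltaAY (bondOpCoordsRY bondOpCoordsRY_apply restrictScalars_bondOpCoordsY volY volY_pos)
open Literature.MathematicalPhysics.QuantumFieldTheory.Balaban1983to89.B9SectBGWordDeltaAQY (QbQY QsbVQY QbQC QsbQC)
open Literature.MathematicalPhysics.QuantumFieldTheory.Balaban1983to89.B9SectBQLettersL2QY (QbQY2 QsbQY2 QbQC2 QsbQC2)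
open Literature.MathematicalPhysics.QuantumFieldTheory.Balaban1983to89.B9SectBQSizesY (norm_real_smul_le one_le_exp_mul_exp_neg)
open Literature.MathematicalPhysics.QuantumFieldTheory.Balaban1983to89.B9SectBL2GReadY (indB indB_nonneg_le_one hasL2Majorant_conjB_of_indBound l2NormB_eq l2OfYB_eq_l2n)
open Literature.MathematicalPhysics.QuantumFieldTheory.Balaban1983to89.B9SectBL2GReadCodedY (hasL2Majorant_conj_bondOpCoordsRY)
open Literature.MathematicalPhysics.QuantumFieldTheory.Balaban1983to89.B9SectBQLettersL2Y (sqv sqv_nonneg sqv_mul_sqv indB_of_eq indB_of_ne sum_eq_sum_repBondY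
  sum_comp_repBondY_le norm_liftY_apply_le)

variable {d ℓ : ℕ} {hd : 1 ≤ d + 1} {hL : Odd (ℓ + 1) ∧ 1 < ℓ + 1} {b₀ b₁ : ℝ}
variable {𝔸 : Type} [NormedRing 𝔸] [NormedAlgebra ℂ 𝔸] [CompleteSpace 𝔸]
variable {ι : Type} [Fintype ι]
variable (i : KIdx d ℓ hd hL b₀ b₁) (𝔮 : CfgY 𝔸 i → ((FBondY i → 𝔸) →ₗ[ℂ] (IBondY i → 𝔸)))
  (𝔮s : CfgY 𝔸 i → ((IBondY i → 𝔸) →ₗ[ℂ] (FBondY i → 𝔸))) (b : Module.Basis ι ℝ 𝔸) (ιB : BlkY i → IBondY i)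

/-! ## §1 ★★ Schur's test with an abstract kernel -/

section Schur

omit [CompleteSpace 𝔸] in
/-- ★★ **SCHUR's TEST, `Q` SIDE, ABSTRACT KERNEL**: an `ℝ`-letter `T` vanishing off the representatives with `‖(TΛ)(rep κ)‖ ≦ √vol(κ)·c·Σ_f k(κ,f)·‖Λ(f)‖` for a kernel
`k ≧ 0` with rows `Σ_f k(κ,f) ≦ R`, volume-weighted columns RESTRICTED TO THE REPRESENTATIVES OF ONE LABELLED BLOCK `Σ_κ 1_{y}(rep κ)·vol(κ)·k(κ,f) ≦ Cv` (the k-uniform form: at print's knit letter every level's box meets a fine bond, only the block restriction keeps the column mass O(1)) and support radius `r` in the labelled blocks `ιB ∘ blkV1`, satisfies for `J ⊗ E`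
(`‖E‖ ≦ 1`, `J` supported in the labelled block `y′`) `‖1_{Δ(y)}·T(J ⊗ E)‖₂ ≦ c·√(R·Cv)·e^{δr}·e^{−δ·d(y,y′)}·‖J‖₂` (`δ ≧ 0`) — `B9SectBQLettersL2Y.l2_indB_le_of_avg` with
`|qK|` abstracted. [cite: Balaban1985BackgroundPropagators, (3.12)–(3.15) pp.392–393; Balaban1984PropagatorsII, (2.20) p.226, Prop. 2.6 (2.140) p.247] -/
theorem l2_indB_le_of_kernel {T : Module.End ℝ (FBondY i → 𝔸)} {c : ℝ} (hc : 0 ≤ c) (k : IBondY i → FBondY i → ℝ) (hk : ∀ κ f, 0 ≤ k κ f)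
    {R Cv r : ℝ} (hR : 0 ≤ R) (hCv : 0 ≤ Cv) (hrow : ∀ κ, ∑ f, k κ f ≤ R)
    (hcolV : ∀ (f : FBondY i) (y : IBondY i), ∑ κ, indB i ιB y (repBondY i κ) * (volY i κ * k κ f) ≤ Cv)
    (hsupp : ∀ κ f, k κ f ≠ 0 → (geo9K i).dist (ιB (blkV1 i.hN i.D (repBondY i κ))) (ιB (blkV1 i.hN i.D f)) ≤ r)
    (hoffT : ∀ (Λ : FBondY i → 𝔸) (q : FBondY i), q ∉ Set.range (repBondY i) → T Λ q = 0)
    (hrep : ∀ (Λ : FBondY i → 𝔸) (κ : IBondY i), ‖T Λ (repBondY i κ)‖ ≤ sqv i κ * (c * ∑ f, k κ f * ‖Λ f‖))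
    {δ : ℝ} (hδ : 0 ≤ δ) (J : FBondY i → ℝ) (E : 𝔸) (y y' : IBondY i) (hE : ‖E‖ ≤ 1) (hJ : ∀ q, ιB (blkV1 i.hN i.D q) ≠ y' → J q = 0) :
    l2OfY (indB i ιB y) (T (liftY J E)) ≤ c * Real.sqrt (R * Cv) *
      (Real.exp (δ * r) * Real.exp (-(δ * (geo9K i).dist y y'))) * (geo9K i).l2Norm (.inr J) := by
  classical
  set Λ : FBondY i → 𝔸 := liftY J E with hΛ
  set ex : ℝ := Real.exp (δ * r) * Real.exp (-(δ * (geo9K i).dist y y')) with hex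
  have hRC : 0 ≤ R * Cv := mul_nonneg hR hCv
  have hex0 : 0 ≤ ex := by positivity
  have hΛf : ∀ f, ‖Λ f‖ ≤ |J f| := fun f => norm_liftY_apply_le i hE f
  have hK2 : ∀ s e : ℝ, 0 ≤ s → (c * Real.sqrt s * e) ^ 2 = c ^ 2 * s * e ^ 2 := fun s e hs => by
    rw [mul_pow, mul_pow, Real.sq_sqrt hs]
  -- the volume-weighted column bound, with the indicator
  have hA : ∀ f, c ^ 2 * R * ∑ κ, indB i ιB y (repBondY i κ) * (volY i κ * k κ f) ≤ c ^ 2 * R * Cv := fun f =>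
    mul_le_mul_of_nonneg_left (hcolV f y) (mul_nonneg (sq_nonneg c) hR)
  -- pointwise in `κ`: Cauchy–Schwarz with the weights `k(κ,·)` of mass `≦ R`
  have hpt : ∀ κ, (indB i ιB y (repBondY i κ) * ‖T Λ (repBondY i κ)‖) ^ 2 ≤
      indB i ιB y (repBondY i κ) * (c ^ 2 * R * ∑ f, volY i κ * k κ f * J f ^ 2) := by
    intro κ
    by_cases hy : ιB (blkV1 i.hN i.D (repBondY i κ)) = y
    · rw [indB_of_eq i ιB hy, one_mul, one_mul]
      have hCS : (∑ f, k κ f * |J f|) ^ 2 ≤ (∑ f, k κ f) * ∑ f, k κ f * J f ^ 2 :=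
        Finset.sum_sq_le_sum_mul_sum_of_sq_le_mul _ (fun f _ => hk κ f) (fun f _ => mul_nonneg (hk κ f) (sq_nonneg _))
          fun f _ => by rw [mul_pow, sq_abs (J f)]; exact le_of_eq (by ring)
      have hn' : ‖T Λ (repBondY i κ)‖ ≤ sqv i κ * (c * ∑ f, k κ f * |J f|) :=
        (hrep Λ κ).trans (mul_le_mul_of_nonneg_left (mul_le_mul_of_nonneg_left
          (Finset.sum_le_sum fun f _ => mul_le_mul_of_nonneg_left (hΛf f) (hk κ f)) hc) (sqv_nonneg i κ))
      have hG0 : 0 ≤ ∑ f, k κ f * J f ^ 2 := Finset.sum_nonneg fun f _ => mul_nonneg (hk κ f) (sq_nonneg _)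
      calc ‖T Λ (repBondY i κ)‖ ^ 2 ≤ (sqv i κ * (c * ∑ f, k κ f * |J f|)) ^ 2 := pow_le_pow_left₀ (norm_nonneg _) hn' 2
        _ = volY i κ * c ^ 2 * (∑ f, k κ f * |J f|) ^ 2 := by rw [mul_pow, mul_pow, pow_two (sqv i κ), sqv_mul_sqv]; ring
        _ ≤ volY i κ * c ^ 2 * ((∑ f, k κ f) * ∑ f, k κ f * J f ^ 2) :=
            mul_le_mul_of_nonneg_left hCS (mul_nonneg (volY_pos i κ).le (sq_nonneg _))
        _ ≤ volY i κ * c ^ 2 * (R * ∑ f, k κ f * J f ^ 2) :=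
            mul_le_mul_of_nonneg_left (mul_le_mul_of_nonneg_right (hrow κ) hG0) (mul_nonneg (volY_pos i κ).le (sq_nonneg _))
        _ = c ^ 2 * R * ∑ f, volY i κ * k κ f * J f ^ 2 := by
            rw [Finset.mul_sum, Finset.mul_sum, Finset.mul_sum]
            exact Finset.sum_congr rfl fun f _ => by ring
    · rw [indB_of_ne i ιB hy, zero_mul, zero_mul, zero_pow two_ne_zero]
  -- the sum of squares
  have hS : ∑ q, (indB i ιB y q * ‖T Λ q‖) ^ 2 ≤ (c * Real.sqrt (R * Cv) * ex) ^ 2 * ∑ q, J q ^ 2 := by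
    rw [sum_eq_sum_repBondY i (fun q => (indB i ιB y q * ‖T Λ q‖) ^ 2) fun q hq => by
      rw [hoffT Λ q hq, norm_zero, mul_zero, zero_pow two_ne_zero]]
    calc ∑ κ, (indB i ιB y (repBondY i κ) * ‖T Λ (repBondY i κ)‖) ^ 2
        ≤ ∑ κ, indB i ιB y (repBondY i κ) * (c ^ 2 * R * ∑ f, volY i κ * k κ f * J f ^ 2) := Finset.sum_le_sum fun κ _ => hpt κ
      _ = ∑ f, J f ^ 2 * (c ^ 2 * R * ∑ κ, indB i ιB y (repBondY i κ) * (volY i κ * k κ f)) := by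
          simp only [Finset.mul_sum]
          rw [Finset.sum_comm]
          exact Finset.sum_congr rfl fun f _ => Finset.sum_congr rfl fun κ _ => by ring
      _ ≤ ∑ f, J f ^ 2 * (c ^ 2 * (R * Cv) * ex ^ 2) := Finset.sum_le_sum fun f _ => ?_
      _ = (c * Real.sqrt (R * Cv) * ex) ^ 2 * ∑ q, J q ^ 2 := by rw [hK2 (R * Cv) ex hRC, ← Finset.sum_mul, mul_comm]
    -- the per-bond factor
    by_cases hJf : J f = 0
    · rw [hJf, zero_pow two_ne_zero, zero_mul, zero_mul]
    · have hyf : ιB (blkV1 i.hN i.D f) = y' := not_not.1 (mt (hJ f) hJf)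
      refine mul_le_mul_of_nonneg_left ?_ (sq_nonneg _)
      by_cases hex' : ∃ κ, ιB (blkV1 i.hN i.D (repBondY i κ)) = y ∧ k κ f ≠ 0
      · obtain ⟨κ, hκy, hq⟩ := hex'
        have hdist : (geo9K i).dist y y' ≤ r := by rw [← hκy, ← hyf]; exact hsupp κ f hq
        have h1 : 1 ≤ ex ^ 2 := one_le_pow₀ (one_le_exp_mul_exp_neg hδ hdist)
        calc c ^ 2 * R * ∑ κ, indB i ιB y (repBondY i κ) * (volY i κ * k κ f) ≤ c ^ 2 * R * Cv := hA f
          _ = c ^ 2 * (R * Cv) * 1 := by ring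
          _ ≤ c ^ 2 * (R * Cv) * ex ^ 2 := mul_le_mul_of_nonneg_left h1 (by positivity)
      · have h0 : ∑ κ, indB i ιB y (repBondY i κ) * (volY i κ * k κ f) = 0 := Finset.sum_eq_zero fun κ _ => by
          by_cases hy : ιB (blkV1 i.hN i.D (repBondY i κ)) = y
          · have hq : k κ f = 0 := by by_contra hq; exact hex' ⟨κ, hy, hq⟩
            rw [hq, mul_zero, mul_zero]
          · rw [indB_of_ne i ιB hy, zero_mul]
        rw [h0, mul_zero]; positivity
  -- the square roots
  have hK0 : 0 ≤ c * Real.sqrt (R * Cv) * ex := by positivity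
  rw [l2OfY, l2NormB_eq]
  calc Real.sqrt (∑ q, (indB i ιB y q * ‖T Λ q‖) ^ 2) ≤ Real.sqrt ((c * Real.sqrt (R * Cv) * ex) ^ 2 * ∑ q, J q ^ 2) := Real.sqrt_le_sqrt hS
    _ = c * Real.sqrt (R * Cv) * ex * Real.sqrt (∑ q, J q ^ 2) := by rw [Real.sqrt_mul (sq_nonneg _), Real.sqrt_sq hK0]

omit [CompleteSpace 𝔸] in
/-- ★★ **SCHUR's TEST, `Q*` SIDE, ABSTRACT KERNEL**: an `ℝ`-letter `T` with `‖(TΛ)(q)‖ ≦ c·Σ_κ k(κ,q)·√vol(κ)·‖Λ(rep κ)‖` (kernel `k ≧ 0`, rows `≦ R`, volume-weighted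
columns `≦ Cv`, support radius `r`) satisfies `‖1_{Δ(y)}·T(J ⊗ E)‖₂ ≦ c·√(R·Cv)·e^{δr}·e^{−δ·d(y,y′)}·‖J‖₂` — `B9SectBQLettersL2Y.l2_indB_le_of_adjAvg` with `|qK|` abstracted.
[cite: Balaban1985BackgroundPropagators, (3.13)–(3.15) pp.392–393; Balaban1984PropagatorsII, (2.19)–(2.20) p.226, Prop. 2.6 (2.140) p.247] -/
theorem l2_indB_le_of_adjKernel {T : Module.End ℝ (FBondY i → 𝔸)} {c : ℝ} (hc : 0 ≤ c) (k : IBondY i → FBondY i → ℝ) (hk : ∀ κ f, 0 ≤ k κ f)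
    {R Cv r : ℝ} (hR : 0 ≤ R) (hCv : 0 ≤ Cv) (hrow : ∀ κ, ∑ f, k κ f ≤ R)
    (hcolV : ∀ (f : FBondY i) (y : IBondY i), ∑ κ, indB i ιB y (repBondY i κ) * (volY i κ * k κ f) ≤ Cv)
    (hsupp : ∀ κ f, k κ f ≠ 0 → (geo9K i).dist (ιB (blkV1 i.hN i.D (repBondY i κ))) (ιB (blkV1 i.hN i.D f)) ≤ r)
    (hT : ∀ (Λ : FBondY i → 𝔸) (q : FBondY i), ‖T Λ q‖ ≤ c * ∑ κ, k κ q * (sqv i κ * ‖Λ (repBondY i κ)‖))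
    {δ : ℝ} (hδ : 0 ≤ δ) (J : FBondY i → ℝ) (E : 𝔸) (y y' : IBondY i) (hE : ‖E‖ ≤ 1) (hJ : ∀ q, ιB (blkV1 i.hN i.D q) ≠ y' → J q = 0) :
    l2OfY (indB i ιB y) (T (liftY J E)) ≤ c * Real.sqrt (R * Cv) *
      (Real.exp (δ * r) * Real.exp (-(δ * (geo9K i).dist y y'))) * (geo9K i).l2Norm (.inr J) := by
  classical
  set Λ : FBondY i → 𝔸 := liftY J E with hΛ
  set ex : ℝ := Real.exp (δ * r) * Real.exp (-(δ * (geo9K i).dist y y')) with hex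
  have hRC : 0 ≤ R * Cv := mul_nonneg hR hCv
  have hex0 : 0 ≤ ex := by positivity
  have hΛf : ∀ f, ‖Λ f‖ ≤ |J f| := fun f => norm_liftY_apply_le i hE f
  have hK2 : ∀ s e : ℝ, 0 ≤ s → (c * Real.sqrt s * e) ^ 2 = c ^ 2 * s * e ^ 2 := fun s e hs => by
    rw [mul_pow, mul_pow, Real.sq_sqrt hs]
  -- `J` lives in the block `y′`: insert its indicator on the representatives
  have hJind : ∀ κ, |J (repBondY i κ)| = indB i ιB y' (repBondY i κ) * |J (repBondY i κ)| := fun κ => by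
    by_cases hy : ιB (blkV1 i.hN i.D (repBondY i κ)) = y'
    · rw [indB_of_eq i ιB hy, one_mul]
    · rw [hJ _ hy, abs_zero, mul_zero]
  -- pointwise in `q`: Cauchy–Schwarz with the weights `k(κ,q)·1_{y′}(rep κ)` against `vol`
  have hpt : ∀ q, (indB i ιB y q * ‖T Λ q‖) ^ 2 ≤ indB i ιB y q * (c ^ 2 * Cv * ∑ κ, k κ q * J (repBondY i κ) ^ 2) := by
    intro q
    by_cases hy : ιB (blkV1 i.hN i.D q) = y
    · rw [indB_of_eq i ιB hy, one_mul, one_mul]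
      have hn' : ‖T Λ q‖ ≤ c * ∑ κ, k κ q * (sqv i κ * (indB i ιB y' (repBondY i κ) * |J (repBondY i κ)|)) :=
        (hT Λ q).trans (mul_le_mul_of_nonneg_left (Finset.sum_le_sum fun κ _ =>
          mul_le_mul_of_nonneg_left (mul_le_mul_of_nonneg_left ((hΛf _).trans (le_of_eq (hJind κ))) (sqv_nonneg i κ)) (hk κ q)) hc)
      have hCS : (∑ κ, k κ q * (sqv i κ * (indB i ιB y' (repBondY i κ) * |J (repBondY i κ)|))) ^ 2 ≤
          (∑ κ, indB i ιB y' (repBondY i κ) * (volY i κ * k κ q)) * ∑ κ, k κ q * J (repBondY i κ) ^ 2 :=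
        Finset.sum_sq_le_sum_mul_sum_of_sq_le_mul _ (fun κ _ => mul_nonneg (indB_nonneg_le_one i ιB y' _).1 (mul_nonneg (volY_pos i κ).le (hk κ q)))
          (fun κ _ => mul_nonneg (hk κ q) (sq_nonneg _)) fun κ _ => by
            have hind := indB_nonneg_le_one i ιB y' (repBondY i κ)
            have hsq : indB i ιB y' (repBondY i κ) ^ 2 ≤ indB i ιB y' (repBondY i κ) := by nlinarith [hind.1, hind.2]
            have h0 : 0 ≤ k κ q ^ 2 * volY i κ * J (repBondY i κ) ^ 2 :=
              mul_nonneg (mul_nonneg (sq_nonneg _) (volY_pos i κ).le) (sq_nonneg _)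
            calc (k κ q * (sqv i κ * (indB i ιB y' (repBondY i κ) * |J (repBondY i κ)|))) ^ 2
                = indB i ιB y' (repBondY i κ) ^ 2 * (k κ q ^ 2 * volY i κ * J (repBondY i κ) ^ 2) := by
                  rw [mul_pow, mul_pow, mul_pow, sq_abs (J _), pow_two (sqv i κ), sqv_mul_sqv]; ring
              _ ≤ indB i ιB y' (repBondY i κ) * (k κ q ^ 2 * volY i κ * J (repBondY i κ) ^ 2) := mul_le_mul_of_nonneg_right hsq h0
              _ = indB i ιB y' (repBondY i κ) * (volY i κ * k κ q) * (k κ q * J (repBondY i κ) ^ 2) := by ring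
      have hcolv : ∑ κ, indB i ιB y' (repBondY i κ) * (volY i κ * k κ q) ≤ Cv := hcolV q y'
      have hG0 : 0 ≤ ∑ κ, k κ q * J (repBondY i κ) ^ 2 := Finset.sum_nonneg fun κ _ => mul_nonneg (hk κ q) (sq_nonneg _)
      calc ‖T Λ q‖ ^ 2 ≤ (c * ∑ κ, k κ q * (sqv i κ * (indB i ιB y' (repBondY i κ) * |J (repBondY i κ)|))) ^ 2 :=
            pow_le_pow_left₀ (norm_nonneg _) hn' 2
        _ = c ^ 2 * (∑ κ, k κ q * (sqv i κ * (indB i ιB y' (repBondY i κ) * |J (repBondY i κ)|))) ^ 2 := mul_pow _ _ _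
        _ ≤ c ^ 2 * ((∑ κ, indB i ιB y' (repBondY i κ) * (volY i κ * k κ q)) * ∑ κ, k κ q * J (repBondY i κ) ^ 2) :=
            mul_le_mul_of_nonneg_left hCS (sq_nonneg _)
        _ ≤ c ^ 2 * (Cv * ∑ κ, k κ q * J (repBondY i κ) ^ 2) :=
            mul_le_mul_of_nonneg_left (mul_le_mul_of_nonneg_right hcolv hG0) (sq_nonneg _)
        _ = c ^ 2 * Cv * ∑ κ, k κ q * J (repBondY i κ) ^ 2 := by ring
    · rw [indB_of_ne i ιB hy, zero_mul, zero_mul, zero_pow two_ne_zero]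
  have hS : ∑ q, (indB i ιB y q * ‖T Λ q‖) ^ 2 ≤ (c * Real.sqrt (R * Cv) * ex) ^ 2 * ∑ q, J q ^ 2 := by
    calc ∑ q, (indB i ιB y q * ‖T Λ q‖) ^ 2
        ≤ ∑ q, indB i ιB y q * (c ^ 2 * Cv * ∑ κ, k κ q * J (repBondY i κ) ^ 2) := Finset.sum_le_sum fun q _ => hpt q
      _ = ∑ κ, J (repBondY i κ) ^ 2 * (c ^ 2 * Cv * ∑ q, indB i ιB y q * k κ q) := by
          simp only [Finset.mul_sum]
          rw [Finset.sum_comm]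
          exact Finset.sum_congr rfl fun κ _ => Finset.sum_congr rfl fun q _ => by ring
      _ ≤ ∑ κ, J (repBondY i κ) ^ 2 * (c ^ 2 * (R * Cv) * ex ^ 2) := Finset.sum_le_sum fun κ _ => ?_
      _ ≤ (∑ q, J q ^ 2) * (c ^ 2 * (R * Cv) * ex ^ 2) := by
          rw [← Finset.sum_mul]
          exact mul_le_mul_of_nonneg_right (sum_comp_repBondY_le i (fun q => J q ^ 2) fun q => sq_nonneg _) (by positivity)
      _ = (c * Real.sqrt (R * Cv) * ex) ^ 2 * ∑ q, J q ^ 2 := by rw [hK2 (R * Cv) ex hRC, mul_comm]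
    by_cases hJκ : J (repBondY i κ) = 0
    · rw [hJκ, zero_pow two_ne_zero, zero_mul, zero_mul]
    · have hyκ : ιB (blkV1 i.hN i.D (repBondY i κ)) = y' := not_not.1 (mt (hJ _) hJκ)
      refine mul_le_mul_of_nonneg_left ?_ (sq_nonneg _)
      by_cases hex' : ∃ q, ιB (blkV1 i.hN i.D q) = y ∧ k κ q ≠ 0
      · obtain ⟨q, hqy, hq⟩ := hex'
        have hdist : (geo9K i).dist y y' ≤ r := by
          rw [geo9K_dist_comm, ← hqy, ← hyκ]; exact hsupp κ q hq
        have h1 : 1 ≤ ex ^ 2 := one_le_pow₀ (one_le_exp_mul_exp_neg hδ hdist)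
        have hrow' : ∑ q, indB i ιB y q * k κ q ≤ R := by
          calc ∑ q, indB i ιB y q * k κ q ≤ ∑ q, k κ q := Finset.sum_le_sum fun q _ => by
                  have h01 := indB_nonneg_le_one i ιB y q
                  have h0 := hk κ q
                  nlinarith
            _ ≤ R := hrow κ
        calc c ^ 2 * Cv * ∑ q, indB i ιB y q * k κ q ≤ c ^ 2 * Cv * R := mul_le_mul_of_nonneg_left hrow' (by positivity)
          _ = c ^ 2 * (R * Cv) * 1 := by ring
          _ ≤ c ^ 2 * (R * Cv) * ex ^ 2 := mul_le_mul_of_nonneg_left h1 (by positivity)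
      · have h0 : ∑ q, indB i ιB y q * k κ q = 0 := Finset.sum_eq_zero fun q _ => by
          by_cases hy : ιB (blkV1 i.hN i.D q) = y
          · have hq : k κ q = 0 := by by_contra hq; exact hex' ⟨q, hy, hq⟩
            rw [hq, mul_zero]
          · rw [indB_of_ne i ιB hy, zero_mul]
        rw [h0, mul_zero]; positivity
  have hK0 : 0 ≤ c * Real.sqrt (R * Cv) * ex := by positivity
  rw [l2OfY, l2NormB_eq]
  calc Real.sqrt (∑ q, (indB i ιB y q * ‖T Λ q‖) ^ 2) ≤ Real.sqrt ((c * Real.sqrt (R * Cv) * ex) ^ 2 * ∑ q, J q ^ 2) := Real.sqrt_le_sqrt hS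
    _ = c * Real.sqrt (R * Cv) * ex * Real.sqrt (∑ q, J q ^ 2) := by rw [Real.sqrt_mul (sq_nonneg _), Real.sqrt_sq hK0]

end Schur

/-! ## §2 ★★ Kernel data ⟹ block-`ℓ²` majorants of the `ℓ²` coded letters `QbQC2 𝔮`, `QsbQC2 𝔮s` -/

section Letters

variable [Fintype (geo9K i).Site] [DecidableEq (geo9K i).Site] {Rr : ℝ} {Hp : Prop}

/-- ★★ **ROW KERNEL ⟹ (3.15) BLOCK-`ℓ²` MAJORANT OF `Qb2 = ext∘√vol∘𝔮(U)`**: `QbQC2 𝔮 b (base U) ≺₂ (√|ι|·M₂Σ‖b_j‖)·√(R·Cv)·e^{δr}·e^{−δd}`.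
[cite: Balaban1985BackgroundPropagators, (3.12)–(3.15) pp.392–393; Balaban1984PropagatorsII, (2.20) p.226, Prop. 2.6 (2.140) p.247, (2.51) p.232] -/
theorem hasL2Majorant_QbQC2_of_rowKernel {M₂ : ℝ} (hM₂ : 0 ≤ M₂)
    (hrepr : ∀ (v : 𝔸) (j : ι), |b.repr v j| ≤ M₂ * ‖v‖) {U : CfgY 𝔸 i}
    (k : IBondY i → FBondY i → ℝ) (hk : ∀ κ f, 0 ≤ k κ f)
    (hrowT : ∀ (Λ : FBondY i → 𝔸) (κ : IBondY i), ‖𝔮 U Λ κ‖ ≤ ∑ f, k κ f * ‖Λ f‖)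
    {R Cv r : ℝ} (hR : 0 ≤ R) (hCv : 0 ≤ Cv) (hrow : ∀ κ, ∑ f, k κ f ≤ R)
    (hcolV : ∀ (f : FBondY i) (y : IBondY i), ∑ κ, indB i ιB y (repBondY i κ) * (volY i κ * k κ f) ≤ Cv)
    (hsupp : ∀ κ f, k κ f ≠ 0 → (geo9K i).dist (ιB (blkV1 i.hN i.D (repBondY i κ))) (ιB (blkV1 i.hN i.D f)) ≤ r)
    {δ : ℝ} (hδ : 0 ≤ δ) :
    HasL2Majorant (g := toB6 (geo9K i) Rr Hp) (fun q : (Fin (d + 1) × SiteY i) × ι => blkC i ιB q.1.2) (QbQC2 i 𝔮 b (.base U))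
      (fun a a' => (Real.sqrt (Fintype.card ι) * M₂ * ∑ j, ‖b j‖) * (1 * Real.sqrt (R * Cv) *
        (Real.exp (δ * r) * Real.exp (-(δ * (geo9K i).dist a a'))))) := by
  classical
  have hQ : QbQC2 i 𝔮 b (.base U) = conj b (bondOpCoordsRY i ((QbQY2 i 𝔮 U).restrictScalars ℝ)) := by
    rw [QbQC2, restrictScalars_bondOpCoordsY, decY_base]
  rw [hQ]
  refine hasL2Majorant_conj_bondOpCoordsRY i b ιB _
    (hasL2Majorant_conjB_of_indBound i ιB b hM₂ hrepr Rr Hp _ _ (fun a a' => by positivity) fun J E y y' hE hJ =>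
      l2_indB_le_of_kernel i ιB zero_le_one k hk hR hCv hrow hcolV hsupp (fun Λ q hq => ?_) (fun Λ κ => ?_) hδ J E y y' hE hJ)
  · rw [LinearMap.restrictScalars_apply]
    simp only [QbQY2, LinearMap.comp_apply]
    exact extBondY_apply_of_not_mem_range i _ hq
  · rw [LinearMap.restrictScalars_apply]
    simp only [QbQY2, LinearMap.comp_apply, extBondY_apply_repBondY, liftMatY_diagonal_apply]
    rw [norm_smul, Complex.norm_real, Real.norm_eq_abs, abs_of_nonneg (sqv_nonneg i κ), one_mul]
    exact mul_le_mul_of_nonneg_left (hrowT Λ κ) (sqv_nonneg i κ)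

/-- ★★ **COLUMN KERNEL ⟹ (3.15) BLOCK-`ℓ²` MAJORANT OF `Qsb2 = 𝔮s(U)∘√vol∘res`**: `QsbQC2 𝔮s b (base U) ≺₂ (√|ι|·M₂Σ‖b_j‖)·√(R·Cv)·e^{δr}·e^{−δd}`.
[cite: Balaban1985BackgroundPropagators, (3.13)–(3.15) pp.392–393; Balaban1984PropagatorsII, (2.19)–(2.20) p.226, Prop. 2.6 (2.140) p.247, (2.51) p.232] -/
theorem hasL2Majorant_QsbQC2_of_colKernel {M₂ : ℝ} (hM₂ : 0 ≤ M₂)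
    (hrepr : ∀ (v : 𝔸) (j : ι), |b.repr v j| ≤ M₂ * ‖v‖) {U : CfgY 𝔸 i}
    (k : IBondY i → FBondY i → ℝ) (hk : ∀ κ f, 0 ≤ k κ f)
    (hcolT : ∀ (Ψ : IBondY i → 𝔸) (f : FBondY i), ‖𝔮s U Ψ f‖ ≤ ∑ κ, k κ f * ‖Ψ κ‖)
    {R Cv r : ℝ} (hR : 0 ≤ R) (hCv : 0 ≤ Cv) (hrow : ∀ κ, ∑ f, k κ f ≤ R)
    (hcolV : ∀ (f : FBondY i) (y : IBondY i), ∑ κ, indB i ιB y (repBondY i κ) * (volY i κ * k κ f) ≤ Cv)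
    (hsupp : ∀ κ f, k κ f ≠ 0 → (geo9K i).dist (ιB (blkV1 i.hN i.D (repBondY i κ))) (ιB (blkV1 i.hN i.D f)) ≤ r)
    {δ : ℝ} (hδ : 0 ≤ δ) :
    HasL2Majorant (g := toB6 (geo9K i) Rr Hp) (fun q : (Fin (d + 1) × SiteY i) × ι => blkC i ιB q.1.2) (QsbQC2 i 𝔮s b (.base U))
      (fun a a' => (Real.sqrt (Fintype.card ι) * M₂ * ∑ j, ‖b j‖) * (1 * Real.sqrt (R * Cv) *
        (Real.exp (δ * r) * Real.exp (-(δ * (geo9K i).dist a a'))))) := by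
  classical
  have hQ : QsbQC2 i 𝔮s b (.base U) = conj b (bondOpCoordsRY i ((QsbQY2 i 𝔮s U).restrictScalars ℝ)) := by
    rw [QsbQC2, restrictScalars_bondOpCoordsY, decY_base]
  rw [hQ]
  refine hasL2Majorant_conj_bondOpCoordsRY i b ιB _
    (hasL2Majorant_conjB_of_indBound i ιB b hM₂ hrepr Rr Hp _ _ (fun a a' => by positivity) fun J E y y' hE hJ =>
      l2_indB_le_of_adjKernel i ιB zero_le_one k hk hR hCv hrow hcolV hsupp (fun Λ q => ?_) hδ J E y y' hE hJ)
  rw [LinearMap.restrictScalars_apply, one_mul]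
  set Ψ : IBondY i → 𝔸 := fun κ => ((sqv i κ : ℝ) : ℂ) • Λ (repBondY i κ) with hΨ
  have hΨ' : liftMatY 𝔸 (Matrix.diagonal (sqv i)) (resBondY i Λ) = Ψ := funext fun κ => by
    rw [liftMatY_diagonal_apply, resBondY_apply]
  have hval : QsbQY2 i 𝔮s U Λ q = 𝔮s U Ψ q := by
    simp only [QsbQY2, LinearMap.comp_apply, hΨ']
  rw [hval]
  refine (hcolT Ψ q).trans (Finset.sum_le_sum fun κ _ => mul_le_mul_of_nonneg_left (le_of_eq ?_) (hk κ q))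
  rw [hΨ]; dsimp only
  rw [norm_smul, Complex.norm_real, Real.norm_eq_abs, abs_of_nonneg (sqv_nonneg i κ)]

end Letters

/-! ## §4 ★★ The sup law with the BLOCK-RESTRICTED column mass (the k-uniform form for print's knit letter) -/

section SupRestricted

variable [Fintype (geo9K i).Site] {Rr : ℝ} {Hp : Prop}

/-- ★★ **COLUMN KERNEL ⟹ (3.15) BLOCK MAJORANT OF `Qsb = 𝔮s(U)·vol`, BLOCK-RESTRICTED COLUMN MASS**: as `B9SectBQLawsOfKernelY.hasMajorant_QsbQC_of_colKernel`, but the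
volume-weighted column mass is only asked OVER THE INDEX BONDS REPRESENTED IN ONE LABELLED BLOCK: `Σ_κ 1_{y}(rep κ)·vol(κ)·k(κ,f) ≦ C` for every `f, y` — the form
print's knit letter satisfies uniformly in the number of levels (every level's box meets a fine bond; a block holds representatives of boundedly many levels).
[cite: Balaban1985BackgroundPropagators, (3.13)–(3.15) pp.392–393; Balaban1984PropagatorsII, (2.2)–(2.4) p.224, (2.51) p.232] -/
theorem hasMajorant_QsbQC_of_colKernel' {M₂ : ℝ} (hM₂ : 0 ≤ M₂) (hrepr : ∀ (v : 𝔸) (j : ι), |b.repr v j| ≤ M₂ * ‖v‖) {U : CfgY 𝔸 i}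
    (k : IBondY i → FBondY i → ℝ) (hk : ∀ κ f, 0 ≤ k κ f)
    (hcol : ∀ (Ψ : IBondY i → 𝔸) (f : FBondY i), ‖𝔮s U Ψ f‖ ≤ ∑ κ, k κ f * ‖Ψ κ‖)
    {C r : ℝ} (hC : 0 ≤ C) (hsumV : ∀ (f : FBondY i) (y : IBondY i), ∑ κ, indB i ιB y (repBondY i κ) * (volY i κ * k κ f) ≤ C)
    (hsupp : ∀ κ f, k κ f ≠ 0 → (geo9K i).dist (ιB (blkV1 i.hN i.D (repBondY i κ))) (ιB (blkV1 i.hN i.D f)) ≤ r)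
    {δ : ℝ} (hδ : 0 ≤ δ) :
    HasMajorant (g := toB6 (geo9K i) Rr Hp) (fun q : (Fin (d + 1) × SiteY i) × ι => blkC i ιB q.1.2) (QsbQC i 𝔮s b (.base U))
      (fun a a' => (M₂ * ∑ j, ‖b j‖) * (C * Real.exp (δ * r) * Real.exp (-(δ * (geo9K i).dist a a')))) := by
  classical
  have hQ : QsbQC i 𝔮s b (.base U) = conj b (bondOpCoordsRY i ((QsbVQY i 𝔮s U).restrictScalars ℝ)) := by
    rw [QsbQC, restrictScalars_bondOpCoordsY, decY_base]
  refine B9SectBGReadCodedY.hasMajorant_of_eq i hQ (B9SectBGpReadingsY.hasMajorant_conj_of_liftY_bound b (g := toB6 (geo9K i) Rr Hp)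
    (fun z : Fin (d + 1) × SiteY i => blkC i ιB z.2) _ _ M₂ hM₂ hrepr fun f E y' B hE hB hoff hbd z => ?_)
  rw [bondOpCoordsRY_apply, LinearMap.restrictScalars_apply, Node00.bondFunCoordsY_apply]
  set Λ : FBondY i → 𝔸 := (bondFunCoordsY i).symm (liftY f E) with hΛ
  set bd : FBondY i := (bondCoordsY i).symm z with hbd'
  have hz2 : z.2 = B6GlobalChartV1.boxEquiv i.hN bd.src := by
    have : z = bondCoordsY i bd := by rw [hbd', Equiv.apply_symm_apply]
    rw [this, Node00.bondCoordsY_apply]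
  have hΛrep : ∀ κ, ‖Λ (repBondY i κ)‖ ≤ |f (bondCoordsY i (repBondY i κ))| := fun κ => by
    rw [hΛ, B9SectBQSizesY.bondFunCoordsY_symm_liftY]; exact norm_real_smul_le hE
  -- the profile read on the representatives is supported in `y′` and bounded by `B`: `|f(coords(rep κ))| ≤ 1_{y′}(rep κ)·B`
  have hfrep : ∀ κ, |f (bondCoordsY i (repBondY i κ))| ≤ indB i ιB y' (repBondY i κ) * B := fun κ => by
    by_cases hy : ιB (blkV1 i.hN i.D (repBondY i κ)) = y'
    · rw [indB_of_eq i ιB hy, one_mul]; exact hbd _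
    · have hoff' : f (bondCoordsY i (repBondY i κ)) = 0 := hoff (bondCoordsY i (repBondY i κ)) hy
      rw [hoff', abs_zero]; exact mul_nonneg (indB_nonneg_le_one i ιB y' _).1 hB
  have hK0 : 0 ≤ C * Real.exp (δ * r) * Real.exp (-(δ * (geo9K i).dist (blkC i ιB z.2) y')) * B := by positivity
  set Ψ : IBondY i → 𝔸 := fun κ => ((volY i κ : ℝ) : ℂ) • Λ (repBondY i κ) with hΨ
  have hval : QsbVQY i 𝔮s U Λ bd = 𝔮s U Ψ bd := by
    have hΨ' : liftMatY 𝔸 (Matrix.diagonal (volY i)) (resBondY i Λ) = Ψ := funext fun κ => by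
      rw [liftMatY_diagonal_apply, resBondY_apply]
    simp only [QsbVQY, LinearMap.comp_apply, hΨ']
  have hΨle : ∀ κ, ‖Ψ κ‖ ≤ volY i κ * (indB i ιB y' (repBondY i κ) * B) := fun κ => by
    rw [hΨ]; dsimp only
    rw [norm_smul, Complex.norm_real, Real.norm_eq_abs, abs_of_pos (volY_pos i κ)]
    exact mul_le_mul_of_nonneg_left ((hΛrep κ).trans (hfrep κ)) (volY_pos i κ).le
  have hS : ‖𝔮s U Ψ bd‖ ≤ C * B :=
    calc ‖𝔮s U Ψ bd‖ ≤ ∑ κ, k κ bd * ‖Ψ κ‖ := hcol Ψ bd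
      _ ≤ ∑ κ, k κ bd * (volY i κ * (indB i ιB y' (repBondY i κ) * B)) := Finset.sum_le_sum fun κ _ => mul_le_mul_of_nonneg_left (hΨle κ) (hk κ bd)
      _ = (∑ κ, indB i ιB y' (repBondY i κ) * (volY i κ * k κ bd)) * B := by rw [Finset.sum_mul]; exact Finset.sum_congr rfl fun κ _ => by ring
      _ ≤ C * B := mul_le_mul_of_nonneg_right (hsumV bd y') hB
  rw [hval]
  by_cases hex : ∃ κ, k κ bd ≠ 0 ∧ ιB (blkV1 i.hN i.D (repBondY i κ)) = y'
  · obtain ⟨κ₀, hκ₀, hy'⟩ := hex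
    have hdist : (geo9K i).dist (blkC i ιB z.2) y' ≤ r := by
      rw [hz2, ← hy', geo9K_dist_comm]; exact hsupp κ₀ bd hκ₀
    calc ‖𝔮s U Ψ bd‖ ≤ C * B := hS
      _ = C * 1 * B := by rw [mul_one]
      _ ≤ C * (Real.exp (δ * r) * Real.exp (-(δ * (geo9K i).dist (blkC i ιB z.2) y'))) * B := by
          gcongr; exact one_le_exp_mul_exp_neg hδ hdist
      _ = _ := by ring
  · have hS0 : ‖𝔮s U Ψ bd‖ ≤ 0 := by
      refine (hcol Ψ bd).trans (le_of_eq (Finset.sum_eq_zero fun κ _ => ?_))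
      by_cases hkf : k κ bd = 0
      · rw [hkf, zero_mul]
      · have hy : ιB (blkV1 i.hN i.D (repBondY i κ)) ≠ y' := fun h => hex ⟨κ, hkf, h⟩
        have hΨ0 : Ψ κ = 0 := by
          rw [hΨ]; dsimp only
          rw [hΛ, B9SectBQSizesY.bondFunCoordsY_symm_liftY, hoff (bondCoordsY i (repBondY i κ)) hy, Complex.ofReal_zero, zero_smul, smul_zero]
        rw [hΨ0, norm_zero, mul_zero]
    exact hS0.trans hK0

end SupRestricted

/-! ## §3 ★ The member-level packaging: kernel data on the (3.35) class ⟹ the K2-G binder `hQL2` verbatim -/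

section Members

open Literature.MathematicalPhysics.QuantumFieldTheory.Balaban1983to89.B9SectBCodedClassR (RegExtraY bg9YC)

variable {Mstar : ℕ} (P : RegExtraY d ℓ hd hL b₀ b₁ Mstar 𝔸) {J : Type} (f : J → MemberY d ℓ hd hL b₀ b₁ Mstar)
  [∀ x : MemberY d ℓ hd hL b₀ b₁ Mstar, Fintype (geo9Y x).Site] [instDS : ∀ x : MemberY d ℓ hd hL b₀ b₁ Mstar, DecidableEq (geo9Y x).Site]
  (c35 : ℝ) (G : Subgroup 𝔸ˣ)
  (𝔮f : ∀ j : J, CfgY 𝔸 (f j).toKIdx → ((FBondY (f j).toKIdx → 𝔸) →ₗ[ℂ] (IBondY (f j).toKIdx → 𝔸)))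
  (𝔮sf : ∀ j : J, CfgY 𝔸 (f j).toKIdx → ((IBondY (f j).toKIdx → 𝔸) →ₗ[ℂ] (FBondY (f j).toKIdx → 𝔸)))
  (ιBf : ∀ j : J, BlkY (f j).toKIdx → IBondY (f j).toKIdx)

/-- ★ **THE K2-G BLOCK-`ℓ²` SIZE LAW `hQL2` FROM KERNEL DATA ON THE (3.35) CLASS**: kernels `kQ j U ∕ kQs j U` majorising the rows of `𝔮 j U` ∕ the columns of
`𝔮s j U` on the (3.35) class above the thresholds, each with row mass `≦ C`, volume-weighted column mass `≦ C` and support radius `r ≧ 0` in the labelled blocks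
`ιB ∘ blkV1`, give the binder `hQL2` of `B9SectBL2GFrameSelQY.l2GFrame₈CodedOnSelQ` VERBATIM with `κQ2 := (√|ι|·M₂Σ‖b_j‖)·√(C·C)·e^{r}`.
[cite: Balaban1985BackgroundPropagators, (3.15) p.393, (3.35) p.396, (3.46) p.398; Balaban1985Averaging, Prop. 2 p.26; Balaban1984PropagatorsII, Prop. 2.6 (2.140) p.247] -/
theorem hQL2_of_kernels {M₂ : ℝ} (hM₂ : 0 ≤ M₂) (hrepr : ∀ (v : 𝔸) (j : ι), |b.repr v j| ≤ M₂ * ‖v‖) (MInv aInv : ℝ)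
    {C r : ℝ} (hC : 0 ≤ C) (hr : 0 ≤ r)
    (kQ kQs : ∀ j : J, CfgY 𝔸 (f j).toKIdx → IBondY (f j).toKIdx → FBondY (f j).toKIdx → ℝ)
    (hker : ∀ j (α₀ : ℝ) (U : CfgY 𝔸 (f j).toKIdx), MInv ≤ (geo9Y (f j)).M → 0 < α₀ → (geo9Y (f j)).M * α₀ ≤ aInv →
      (bg9YC 𝔸 G P (f j)).Reg335 c35 α₀ U →
      (∀ κ f', 0 ≤ kQ j U κ f') ∧ (∀ (Λ : FBondY (f j).toKIdx → 𝔸) κ, ‖𝔮f j U Λ κ‖ ≤ ∑ f', kQ j U κ f' * ‖Λ f'‖) ∧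
        (∀ κ, ∑ f', kQ j U κ f' ≤ C) ∧ (∀ f' (y : IBondY (f j).toKIdx), ∑ κ, indB (f j).toKIdx (ιBf j) y (repBondY (f j).toKIdx κ) * (volY (f j).toKIdx κ * kQ j U κ f') ≤ C) ∧
        (∀ κ f', kQ j U κ f' ≠ 0 → (geo9K (f j).toKIdx).dist (ιBf j (blkV1 (f j).toKIdx.hN (f j).toKIdx.D (repBondY (f j).toKIdx κ)))
          (ιBf j (blkV1 (f j).toKIdx.hN (f j).toKIdx.D f')) ≤ r) ∧
      (∀ κ f', 0 ≤ kQs j U κ f') ∧ (∀ (Ψ : IBondY (f j).toKIdx → 𝔸) f', ‖𝔮sf j U Ψ f'‖ ≤ ∑ κ, kQs j U κ f' * ‖Ψ κ‖) ∧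
        (∀ κ, ∑ f', kQs j U κ f' ≤ C) ∧ (∀ f' (y : IBondY (f j).toKIdx), ∑ κ, indB (f j).toKIdx (ιBf j) y (repBondY (f j).toKIdx κ) * (volY (f j).toKIdx κ * kQs j U κ f') ≤ C) ∧
        (∀ κ f', kQs j U κ f' ≠ 0 → (geo9K (f j).toKIdx).dist (ιBf j (blkV1 (f j).toKIdx.hN (f j).toKIdx.D (repBondY (f j).toKIdx κ)))
          (ιBf j (blkV1 (f j).toKIdx.hN (f j).toKIdx.D f')) ≤ r)) :
    ∀ j (α₀ : ℝ) (U : CfgY 𝔸 (f j).toKIdx) (δ : ℝ), MInv ≤ (geo9Y (f j)).M → 0 < α₀ → (geo9Y (f j)).M * α₀ ≤ aInv →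
      (bg9YC 𝔸 G P (f j)).Reg335 c35 α₀ U → 0 < δ → δ ≤ 1 →
      HasL2Majorant (g := toB6 (geo9Y (f j)) 0 True) (fun q : (Fin (d + 1) × SiteY (f j).toKIdx) × ι => blkC (f j).toKIdx (ιBf j) q.1.2)
          (QbQC2 (f j).toKIdx (𝔮f j) b (.base U))
          (fun a a' => ((Real.sqrt (Fintype.card ι) * M₂ * ∑ j, ‖b j‖) * (1 * Real.sqrt (C * C)) * Real.exp r) * Real.exp (-(δ * (geo9Y (f j)).dist a a'))) ∧
        HasL2Majorant (g := toB6 (geo9Y (f j)) 0 True) (fun q : (Fin (d + 1) × SiteY (f j).toKIdx) × ι => blkC (f j).toKIdx (ιBf j) q.1.2)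
          (QsbQC2 (f j).toKIdx (𝔮sf j) b (.base U))
          (fun a a' => ((Real.sqrt (Fintype.card ι) * M₂ * ∑ j, ‖b j‖) * (1 * Real.sqrt (C * C)) * Real.exp r) * Real.exp (-(δ * (geo9Y (f j)).dist a a'))) := by
  intro j α₀ U δ hM hα₀ hMa hU hδ hδ1
  letI : Fintype (geo9K (f j).toKIdx).Site := ‹∀ x : MemberY d ℓ hd hL b₀ b₁ Mstar, Fintype (geo9Y x).Site› (f j)
  letI : DecidableEq (geo9K (f j).toKIdx).Site := instDS (f j)
  obtain ⟨hk0, hrowT, hrow, hcolV, hsupp, hks0, hcolT, hrows, hcolVs, hsupps⟩ := hker j α₀ U hM hα₀ hMa hU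
  have hMS : 0 ≤ Real.sqrt (Fintype.card ι) * M₂ * ∑ j, ‖b j‖ :=
    mul_nonneg (mul_nonneg (Real.sqrt_nonneg _) hM₂) (Finset.sum_nonneg fun j _ => norm_nonneg _)
  have her : Real.exp (δ * r) ≤ Real.exp r := Real.exp_le_exp.2 (by nlinarith)
  have hup : ∀ a a' : (geo9K (f j).toKIdx).Site,
      (Real.sqrt (Fintype.card ι) * M₂ * ∑ j, ‖b j‖) * (1 * Real.sqrt (C * C) * (Real.exp (δ * r) * Real.exp (-(δ * (geo9K (f j).toKIdx).dist a a')))) ≤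
        ((Real.sqrt (Fintype.card ι) * M₂ * ∑ j, ‖b j‖) * (1 * Real.sqrt (C * C)) * Real.exp r) * Real.exp (-(δ * (geo9K (f j).toKIdx).dist a a')) :=
    fun a a' => by
    have h0 : 0 ≤ Real.exp (-(δ * (geo9K (f j).toKIdx).dist a a')) := (Real.exp_pos _).le
    have hs : 0 ≤ 1 * Real.sqrt (C * C) := by positivity
    calc (Real.sqrt (Fintype.card ι) * M₂ * ∑ j, ‖b j‖) * (1 * Real.sqrt (C * C) * (Real.exp (δ * r) * Real.exp (-(δ * (geo9K (f j).toKIdx).dist a a'))))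
        = (Real.sqrt (Fintype.card ι) * M₂ * ∑ j, ‖b j‖) * (1 * Real.sqrt (C * C)) * Real.exp (δ * r) * Real.exp (-(δ * (geo9K (f j).toKIdx).dist a a')) := by ring
      _ ≤ (Real.sqrt (Fintype.card ι) * M₂ * ∑ j, ‖b j‖) * (1 * Real.sqrt (C * C)) * Real.exp r * Real.exp (-(δ * (geo9K (f j).toKIdx).dist a a')) := by gcongr
      _ = _ := by ring
  exact ⟨hasL2Majorant_mono _ (hasL2Majorant_QbQC2_of_rowKernel (Rr := 0) (Hp := True) (f j).toKIdx (𝔮f j) b (ιBf j) hM₂ hrepr (kQ j U) hk0 hrowT hC hC hrow hcolV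
      hsupp hδ.le) hup,
    hasL2Majorant_mono _ (hasL2Majorant_QsbQC2_of_colKernel (Rr := 0) (Hp := True) (f j).toKIdx (𝔮sf j) b (ιBf j) hM₂ hrepr (kQs j U) hks0 hcolT hC hC hrows hcolVs
      hsupps hδ.le) hup⟩

omit instDS in
/-- ★ **THE K2-G SIZE LAW `hQ15` FROM KERNEL DATA, BLOCK-RESTRICTED COLUMN MASS** — `B9SectBQLawsOfKernelY.hQ15_of_kernels` with the volume-weighted column mass of
`kQs` asked only over the representatives of one labelled block (the k-uniform form, §4). [cite: Balaban1985BackgroundPropagators, (3.15) p.393, (3.35) p.396; Balaban1985Averaging, Prop. 2 p.26] -/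
theorem hQ15_of_kernels' {M₂ : ℝ} (hM₂ : 0 ≤ M₂) (hrepr : ∀ (v : 𝔸) (j : ι), |b.repr v j| ≤ M₂ * ‖v‖) (MInv aInv : ℝ)
    {C r : ℝ} (hC : 0 ≤ C) (hr : 0 ≤ r)
    (kQ kQs : ∀ j : J, CfgY 𝔸 (f j).toKIdx → IBondY (f j).toKIdx → FBondY (f j).toKIdx → ℝ)
    (hker : ∀ j (α₀ : ℝ) (U : CfgY 𝔸 (f j).toKIdx), MInv ≤ (geo9Y (f j)).M → 0 < α₀ → (geo9Y (f j)).M * α₀ ≤ aInv →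
      (bg9YC 𝔸 G P (f j)).Reg335 c35 α₀ U →
      (∀ κ f', 0 ≤ kQ j U κ f') ∧ (∀ (Λ : FBondY (f j).toKIdx → 𝔸) κ, ‖𝔮f j U Λ κ‖ ≤ ∑ f', kQ j U κ f' * ‖Λ f'‖) ∧
        (∀ κ, ∑ f', kQ j U κ f' ≤ C) ∧
        (∀ κ f', kQ j U κ f' ≠ 0 → (geo9K (f j).toKIdx).dist (blkC (f j).toKIdx (ιBf j) (B6GlobalChartV1.boxEquiv (f j).toKIdx.hN (repBondY (f j).toKIdx κ).src))
          (blkC (f j).toKIdx (ιBf j) (B6GlobalChartV1.boxEquiv (f j).toKIdx.hN f'.src)) ≤ r) ∧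
      (∀ κ f', 0 ≤ kQs j U κ f') ∧ (∀ (Ψ : IBondY (f j).toKIdx → 𝔸) f', ‖𝔮sf j U Ψ f'‖ ≤ ∑ κ, kQs j U κ f' * ‖Ψ κ‖) ∧
        (∀ f' (y : IBondY (f j).toKIdx), ∑ κ, indB (f j).toKIdx (ιBf j) y (repBondY (f j).toKIdx κ) * (volY (f j).toKIdx κ * kQs j U κ f') ≤ C) ∧
        (∀ κ f', kQs j U κ f' ≠ 0 → (geo9K (f j).toKIdx).dist (ιBf j (blkV1 (f j).toKIdx.hN (f j).toKIdx.D (repBondY (f j).toKIdx κ)))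
          (ιBf j (blkV1 (f j).toKIdx.hN (f j).toKIdx.D f')) ≤ r)) :
    ∀ j (α₀ : ℝ) (U : CfgY 𝔸 (f j).toKIdx) (δ : ℝ), MInv ≤ (geo9Y (f j)).M → 0 < α₀ → (geo9Y (f j)).M * α₀ ≤ aInv →
      (bg9YC 𝔸 G P (f j)).Reg335 c35 α₀ U → 0 < δ → δ ≤ 1 →
      HasMajorant (g := toB6 (geo9Y (f j)) 0 True) (fun q : (Fin (d + 1) × SiteY (f j).toKIdx) × ι => blkC (f j).toKIdx (ιBf j) q.1.2)
          (QbQC (f j).toKIdx (𝔮f j) b (.base U)) (fun a a' => ((M₂ * ∑ j, ‖b j‖) * (C * Real.exp r)) * Real.exp (-(δ * (geo9Y (f j)).dist a a'))) ∧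
        HasMajorant (g := toB6 (geo9Y (f j)) 0 True) (fun q : (Fin (d + 1) × SiteY (f j).toKIdx) × ι => blkC (f j).toKIdx (ιBf j) q.1.2)
          (QsbQC (f j).toKIdx (𝔮sf j) b (.base U)) (fun a a' => ((M₂ * ∑ j, ‖b j‖) * (C * Real.exp r)) * Real.exp (-(δ * (geo9Y (f j)).dist a a'))) := by
  intro j α₀ U δ hM hα₀ hMa hU hδ hδ1
  letI : Fintype (geo9K (f j).toKIdx).Site := ‹∀ x : MemberY d ℓ hd hL b₀ b₁ Mstar, Fintype (geo9Y x).Site› (f j)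
  obtain ⟨hk0, hrow, hsum, hsupp, hks0, hcol, hsumV, hsupps⟩ := hker j α₀ U hM hα₀ hMa hU
  have hMS : 0 ≤ M₂ * ∑ j, ‖b j‖ := mul_nonneg hM₂ (Finset.sum_nonneg fun j _ => norm_nonneg _)
  have her : Real.exp (δ * r) ≤ Real.exp r := Real.exp_le_exp.2 (by nlinarith)
  have hup : ∀ a a' : (geo9K (f j).toKIdx).Site,
      (M₂ * ∑ j, ‖b j‖) * (C * Real.exp (δ * r) * Real.exp (-(δ * (geo9K (f j).toKIdx).dist a a'))) ≤
        ((M₂ * ∑ j, ‖b j‖) * (C * Real.exp r)) * Real.exp (-(δ * (geo9K (f j).toKIdx).dist a a')) := fun a a' => by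
    have h0 : 0 ≤ Real.exp (-(δ * (geo9K (f j).toKIdx).dist a a')) := (Real.exp_pos _).le
    calc (M₂ * ∑ j, ‖b j‖) * (C * Real.exp (δ * r) * Real.exp (-(δ * (geo9K (f j).toKIdx).dist a a')))
        = (M₂ * ∑ j, ‖b j‖) * C * Real.exp (δ * r) * Real.exp (-(δ * (geo9K (f j).toKIdx).dist a a')) := by ring
      _ ≤ (M₂ * ∑ j, ‖b j‖) * C * Real.exp r * Real.exp (-(δ * (geo9K (f j).toKIdx).dist a a')) := by gcongr
      _ = _ := by ring
  exact ⟨B6RandomWalk.hasMajorant_mono _ (B9SectBQLawsOfKernelY.hasMajorant_QbQC_of_rowKernel (Rr := 0) (Hp := True) (f j).toKIdx (𝔮f j) b (ιBf j) hM₂ hrepr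
      (kQ j U) hk0 hrow hC hsum hsupp hδ.le) hup,
    B6RandomWalk.hasMajorant_mono _ (hasMajorant_QsbQC_of_colKernel' (Rr := 0) (Hp := True) (f j).toKIdx (𝔮sf j) b (ιBf j) hM₂ hrepr (kQs j U) hks0 hcol hC hsumV
      hsupps hδ.le) hup⟩

end Members

end Literature.MathematicalPhysics.QuantumFieldTheory.Balaban1983to89.B9SectBQLawsL2OfKernelY

end
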